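import Literature.AlgebraicGeometry.Resolution.CompositeValuations
import Literature.AlgebraicGeometry.Resolution.ValuedFunctionFields
import HarnessLib

/-!
# Composite valuations: a residually algebraic subfield of the coarsening scales it into the fine ring

Topic: `Literature/AlgebraicGeometry/Resolution`. One brick of the induction on the height in
M. Temkin, *Inseparable local uniformization*, J. Algebra 373 (2013) 65–119 = arXiv:0804.1554v3,
§4.2 (pp. 50–51). There `K° ⊆ F°` is a valuation ring and its coarsening of height `h - 1`,
`F̃ = F°/𝔪_{F°}` carries the residue valuation ring `F̃°` (image of `K°`;
`residueValuationSubring`, `CompositeValuations.lean`), and `k̄ = k(b) ⊆ F°` is a subfield on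
which `F` is trivially valued and over (the residues of) which `F̃` is algebraic (Step 1, p. 50:
"Choose a subset `b ⊂ F°` such that … `b̃` is a transcendence basis of `F̃` over `k`. It then
follows that `F°` contains a subfield `k̄ = k(b)`, and hence `F` induces a trivial valuation on
`k̄`"; `exists_intermediateField_valuation_eq_one_isResiduallyAlgebraicOver`,
`TranscendentallyImmediate.lean`). Step 1 then silently uses that an affine `k̄`-model of the
generic fibre `X_η` (a finitely generated `k̄`-subalgebra of `F°`) extends to an affine `k`-model
of `K°` ("Note that any refinement `X′_η → X_η` of affine `k̄`-models of `F°` can be extended to a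
refinement `X′ → X` of affine `k`-models of `K°`", p. 50), i.e. that generators chosen in `F°`
can be rescaled by non-zero elements of `k̄` into `K°`. We PROVE this:

* `exists_pow_valuation_eq_of_isAlgebraic` — if `u ≠ 0` is algebraic over a subfield `E` of a
  valued field `(κ₁, W)`, then `w(uⁿ) = w(e)` for some `n ≥ 1` and `0 ≠ e ∈ E` (in a vanishing
  sum two monomials have equal value): the value group is torsion over that of `E`.
* `exists_mul_mem_of_isResiduallyAlgebraicOver` — for `O ≤ O₁` valuation rings of `K` and a
  subfield `E ⊆ K` such that the residue field of `O₁` is algebraic over the residues of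
  `E ∩ O₁`: every `g ∈ O₁` satisfies `c·g ∈ O` for some `0 ≠ c ∈ E`. In other words
  `O₁ = O·Eˣ`, the localization of `O` at `O ∩ E ∖ 0` (the trivial valuation of `F` on `k̄`
  assumed in the paper is not needed for this).

## Sources

* M. Temkin, *Inseparable local uniformization*, arXiv:0804.1554v3, §4.2, Step 1 (p. 50).
* J. Novacoski, M. Spivakovsky (2014), §2.1 and Remark 2.4 (composite valuations), as vendored in
  `CompositeValuations.lean`.
-/

noncomputable section

open IsLocalRing

namespace Literature.AlgebraicGeometry.Resolution

universe u

/-- **Values of algebraic elements are torsion over the values of the ground field**: if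
`u ≠ 0` is algebraic over a subfield `E` of a field `κ₁` with valuation ring `W`, then
`w(uⁿ) = w(e)` for some `n ≥ 1` and some `0 ≠ e ∈ E`. Proof: in `∑ eᵢ uⁱ = 0` the maximal value
of a monomial must be attained twice (otherwise the sum has that value and is non-zero), and
`w(eᵢ uⁱ) = w(eⱼ uʲ)` with `i ≠ j` gives `w(u)^{|i-j|} ∈ w(E^×)`. [folklore] -/
theorem exists_pow_valuation_eq_of_isAlgebraic {κ₁ : Type*} [Field κ₁] (W : ValuationSubring κ₁)
    (E : Subfield κ₁) {u : κ₁} (hu : u ≠ 0) (halg : IsAlgebraic E u) :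
    ∃ n : ℕ, 0 < n ∧ ∃ e ∈ E, e ≠ 0 ∧ W.valuation (u ^ n) = W.valuation e := by
  classical
  obtain ⟨p, hp0, hpu⟩ := halg
  set w := W.valuation with hw
  let f : ℕ → κ₁ := fun i => (p.coeff i : κ₁) * u ^ i
  have hsum : ∑ i ∈ p.support, f i = 0 := by
    have := hpu
    rw [Polynomial.aeval_def, Polynomial.eval₂_eq_sum, Polynomial.sum_def] at this
    exact this
  have hne : p.support.Nonempty :=
    Finset.nonempty_of_ne_empty (mt Polynomial.support_eq_empty.mp hp0)
  have hcoe : ∀ i ∈ p.support, (p.coeff i : κ₁) ≠ 0 := fun i hi h0 =>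
    Polynomial.mem_support_iff.mp hi (Subtype.ext h0)
  have hf0 : ∀ i ∈ p.support, f i ≠ 0 := fun i hi =>
    mul_ne_zero (hcoe i hi) (pow_ne_zero _ hu)
  obtain ⟨j₀, hj₀, hmax⟩ := Finset.exists_max_image p.support (fun i => w (f i)) hne
  -- some other index attains the maximum
  have hex : ∃ j ∈ p.support, j ≠ j₀ ∧ w (f j) = w (f j₀) := by
    by_contra hcon
    have hlt : ∀ j ∈ p.support \ {j₀}, w (f j) < w (f j₀) := fun j hj => by
      obtain ⟨hjs, hjne⟩ := Finset.mem_sdiff.mp hj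
      rw [Finset.mem_singleton] at hjne
      exact lt_of_le_of_ne (hmax j hjs) fun heq => hcon ⟨j, hjs, hjne, heq⟩
    have hv := w.map_sum_eq_of_lt hj₀ hlt
    rw [hsum, map_zero] at hv
    exact hf0 j₀ hj₀ ((map_eq_zero w).mp hv.symm)
  obtain ⟨j, hj, hjne, hjeq⟩ := hex
  have hcj : w (p.coeff j : κ₁) ≠ 0 := (map_ne_zero w).mpr (hcoe j hj)
  have hcj₀ : w (p.coeff j₀ : κ₁) ≠ 0 := (map_ne_zero w).mpr (hcoe j₀ hj₀)
  have hwu : w u ≠ 0 := (map_ne_zero w).mpr hu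
  have hjeq' : w (p.coeff j : κ₁) * w u ^ j = w (p.coeff j₀ : κ₁) * w u ^ j₀ := by
    simpa only [f, map_mul, map_pow] using hjeq
  rcases lt_or_gt_of_ne hjne with hlt | hgt
  · -- `j < j₀`: `w(u)^(j₀ - j) = w(c_j) / w(c_{j₀})`
    refine ⟨j₀ - j, Nat.sub_pos_of_lt hlt, (p.coeff j : κ₁) / (p.coeff j₀ : κ₁),
      E.div_mem (p.coeff j).2 (p.coeff j₀).2, div_ne_zero (hcoe j hj) (hcoe j₀ hj₀), ?_⟩
    rw [map_pow, map_div₀, eq_div_iff hcj₀]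
    have hsplit : w u ^ j₀ = w u ^ j * w u ^ (j₀ - j) := by
      rw [← pow_add, Nat.add_sub_cancel' hlt.le]
    rw [hsplit, ← mul_assoc] at hjeq'
    -- `w(c_j) * w(u)^j = (w(c_{j₀}) * w(u)^j) * w(u)^(j₀-j)`
    have := mul_right_cancel₀ (pow_ne_zero j hwu)
      (show w (p.coeff j : κ₁) * w u ^ j = w (p.coeff j₀ : κ₁) * w u ^ (j₀ - j) * w u ^ j by
        rw [hjeq', mul_right_comm])
    rw [this, mul_comm]
  · -- `j₀ < j`: `w(u)^(j - j₀) = w(c_{j₀}) / w(c_j)`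
    refine ⟨j - j₀, Nat.sub_pos_of_lt hgt, (p.coeff j₀ : κ₁) / (p.coeff j : κ₁),
      E.div_mem (p.coeff j₀).2 (p.coeff j).2, div_ne_zero (hcoe j₀ hj₀) (hcoe j hj), ?_⟩
    rw [map_pow, map_div₀, eq_div_iff hcj]
    have hsplit : w u ^ j = w u ^ j₀ * w u ^ (j - j₀) := by
      rw [← pow_add, Nat.add_sub_cancel' hgt.le]
    rw [hsplit, ← mul_assoc] at hjeq'
    have := mul_right_cancel₀ (pow_ne_zero j₀ hwu)
      (show w (p.coeff j₀ : κ₁) * w u ^ j₀ = w (p.coeff j : κ₁) * w u ^ (j - j₀) * w u ^ j₀ by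
        rw [← hjeq', mul_right_comm])
    rw [this, mul_comm]

variable {K : Type u} [Field K]

/-- **A residually algebraic, trivially valued subfield of the coarsening scales it into the fine
valuation ring** (Temkin 2013, §4.2, Step 1, p. 50, used tacitly: "any refinement `X′_η → X_η`
of affine `k̄`-models of `F°` can be extended to a refinement `X′ → X` of affine `k`-models of
`K°`"): let `O ≤ O₁` be valuation rings of `K` (`K° ⊆ F°`) and `E ⊆ K` a subfield such that the
residue field of `O₁` is algebraic over the residues of `E ∩ O₁` (`F̃/k̄` algebraic; in the paper
`F` is moreover trivially valued on `E = k̄`, which is not needed). Then for every `g ∈ O₁`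
there is `0 ≠ c ∈ E` with `c·g ∈ O`. Proof: if `g ∉ O` then `u = g⁻¹ ∈ O` is a unit of `O₁` whose residue
`ū ≠ 0` is algebraic over the residues of `E`, so `w(ūⁿ) = w(ē)` for some `n ≥ 1`, `0 ≠ ē`
(`exists_pow_valuation_eq_of_isAlgebraic`, `w` the residue valuation of `O` on `F̃`); lifting
`ē` to `c ∈ E`, the residue of `c gⁿ` is `ē/ūⁿ`, of `w`-value `1`, so `c gⁿ ∈ O`
(`residue_mem_residueValuationSubring_iff`) and `c g = (c gⁿ) uⁿ⁻¹ ∈ O`.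
[cite: Temkin2013, Section 4.2, Step 1 (arXiv:0804.1554v3 p. 50)] -/
theorem exists_mul_mem_of_isResiduallyAlgebraicOver (O O₁ : ValuationSubring K) (h : O ≤ O₁)
    (E : Subfield K) (hres : IsResiduallyAlgebraicOver O₁ E ⊤) {g : K} (hg : g ∈ O₁) :
    ∃ c ∈ E, c ≠ 0 ∧ c * g ∈ O := by
  classical
  by_cases hgO : g ∈ O
  · exact ⟨1, E.one_mem, one_ne_zero, by rwa [one_mul]⟩
  have hg0 : g ≠ 0 := by rintro rfl; exact hgO O.zero_mem
  -- `u = g⁻¹ ∈ O`, a unit of `O₁`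
  set u : K := g⁻¹ with hu_def
  have huO : u ∈ O := (O.mem_or_inv_mem g).resolve_left hgO
  have huO₁ : u ∈ O₁ := h huO
  have hu0 : u ≠ 0 := inv_ne_zero hg0
  let W := residueValuationSubring O O₁ h
  set w := W.valuation with hw
  let ug : O₁ := ⟨u, huO₁⟩
  let gg : O₁ := ⟨g, hg⟩
  have hug : ug * gg = 1 := Subtype.ext (inv_mul_cancel₀ hg0)
  have hunit_u : IsUnit ug := IsUnit.of_mul_eq_one gg hug
  have hunit_g : IsUnit gg := IsUnit.of_mul_eq_one ug (by rw [mul_comm]; exact hug)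
  set ubar := residue O₁ ug with hubar
  have hubar0 : ubar ≠ 0 := by
    rw [hubar, Ne, residue_eq_zero_iff]
    exact fun hm => (IsLocalRing.mem_maximalIdeal _).mp hm hunit_u
  -- `ū` is algebraic over the residues of `E`
  have halg : IsAlgebraic (resField O₁ E) ubar :=
    hres ubar (residue_mem_resField O₁ ug (Subfield.mem_top _))
  obtain ⟨n, hn, ebar, hebarE, hebar0, hval⟩ :=
    exists_pow_valuation_eq_of_isAlgebraic W (resField O₁ E) hubar0 halg
  -- lift `ē` to `c ∈ E ∩ O₁`
  obtain ⟨a, haE, hares⟩ := (mem_resField_iff O₁ E ebar).mp hebarE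
  have ha0 : (a : K) ≠ 0 := by
    rintro h0
    apply hebar0
    rw [← hares, show a = 0 from Subtype.ext h0, map_zero]
  refine ⟨a, haE, ha0, ?_⟩
  -- the residue of `c gⁿ` is `ē / ūⁿ`, of `w`-value `1`
  have hres_g : residue O₁ gg = ubar⁻¹ :=
    eq_inv_of_mul_eq_one_left (by rw [hubar, ← map_mul, mul_comm, hug, map_one])
  have hmem_n : (a : K) * g ^ n ∈ O := by
    have hmemO₁ : (a : K) * g ^ n ∈ O₁ := mul_mem a.2 (pow_mem hg n)
    have key : residue O₁ ⟨(a : K) * g ^ n, hmemO₁⟩ = ebar * (ubar ^ n)⁻¹ := by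
      have : (⟨(a : K) * g ^ n, hmemO₁⟩ : O₁) = a * gg ^ n := Subtype.ext (by simp [gg])
      rw [this, map_mul, map_pow, hares, hres_g, inv_pow]
    rw [← residue_mem_residueValuationSubring_iff O O₁ h ⟨(a : K) * g ^ n, hmemO₁⟩, key]
    change ebar * (ubar ^ n)⁻¹ ∈ W
    rw [← W.valuation_le_one_iff, map_mul, map_inv₀, ← hw, ← hval,
      mul_inv_cancel₀ ((map_ne_zero w).mpr (pow_ne_zero n hubar0))]
  -- `c g = (c gⁿ) uⁿ⁻¹`
  obtain ⟨m, rfl⟩ := Nat.exists_eq_succ_of_ne_zero hn.ne'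
  have : (a : K) * g = (a : K) * g ^ (m + 1) * u ^ m := by
    rw [hu_def, pow_succ, inv_pow, mul_assoc, mul_assoc, mul_comm (g ^ m), mul_assoc,
      inv_mul_cancel₀ (pow_ne_zero m hg0), mul_one]
  rw [this]
  exact mul_mem hmem_n (pow_mem huO m)

end Literature.AlgebraicGeometry.Resolution
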